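import Literature.Geometry.ComplexAnalytic.RelativeExponentialChart
import HarnessLib

/-!
# Relative exponential charts are LOCAL ON THE BASE: a pair `(Φ, ex)` that agrees near every point of `U` with some chart is a chart on `U`
# ([BirkenhakeLange2004] §1.1 and Ch. 8 §8.7; [Shimura1963AnalyticFamilies] §2; [DeligneHodgeII1971] §4.4 (4.4.2))

Layer `Literature/Geometry/ComplexAnalytic`, namespace `Literature.Geometry.ComplexAnalytic.IsRelExpChartOn`.  THEOREMS ONLY (no definition,
no named fact, no instance, no notation, no `sorry`).  Cell `hodgecm-mathlib` (D-0151), FLOOR 0, P6 «MOD» (crux hLiu418 =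
stmt-HodgeConjecture-24832, `--supports`), half A line L7, socket `stub_UNIVFAM` (printed letter P-3 «UNIV-FAMILY» ★
`siegelUniversalFamilyUniformisation`): the generic engine of organ O6 «GLUE» of `StubUNIVFAM.closer.skeleton.v1` (LA7-plan deal v1,
2026-09-02): P-3 asks for ONE chart over the whole open `U` of the lift, the line produces charts near each `t₀ ∈ U` whose fibre maps
are CANONICAL (admissible markings, unique); this file turns «a global candidate agreeing locally with charts» into «a chart».
HC_CM is proved only modulo the printed citations until rung 0 closes; this file is generic and changes no count.

THE MATHEMATICS.  In print the relative exponential `exp : Lie(A∕S) → A^an` is a morphism of SHEAVES over `S^an` ([DeligneHodgeII1971]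
(4.4.2): «l'exponentielle définit une suite exacte de faisceaux sur `S^{an}`»); every clause of the trivialised currency ★
`IsRelExpChartOn EB EM p U Φ ex` — holomorphy of the periods and of `ex`, lying over `p`, surjectivity onto fibres, the kernel, the
étale clause — is a statement about a neighbourhood of a single point of `U` (resp. of `U × E`), so it can be checked on an open
cover of `U` by charts that agree with `(Φ, ex)` pointwise ([BirkenhakeLange2004] Ch. 8 §8.7 builds the universal family over `𝔥_g` this
way, chart by chart; [Shimura1963AnalyticFamilies] §2).

* `IsRelExpChartOn.of_local` — if every `b ∈ U` has an open `V ∋ b`, `V ⊆ U`, and a chart `(Φ′, ex′)` over `V` with `Φ′ = Φ` on `V` and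
  `ex′ = ex` on `V × E`, then `(Φ, ex)` is a chart over `U` (and `U` is open).
* `IsRelExpChartOn.congr` — a chart stays a chart after replacing `(Φ, ex)` by any pair agreeing with it on `U` (resp. `U × E`).
* `IsRelExpChartOn.of_forall_exists_nhds` — the same as `of_local` with the cover indexed by the points of `U` and the agreement
  stated as `∀ b′ ∈ V, ∀ x, Φ′ b′ x = Φ b′ x` (the shape in which ★ `SiegelModuli.exists_periodFamily_eq_siegelPeriodMap` /
  `periodFamily_eq_of_eq_siegelPeriodMap` deliver the period agreement).

## References
* [BirkenhakeLange2004] C. Birkenhake, H. Lange, *Complex Abelian Varieties*, 2nd ed. (2004), §1.1; Ch. 8 §8.7 (the universal family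
  over `𝔥_g`, constructed locally).
* [Shimura1963AnalyticFamilies] G. Shimura, *On analytic families of polarized abelian varieties and automorphic functions*, Ann. Math.
  78 (1963), §2.
* [DeligneHodgeII1971] P. Deligne, *Théorie de Hodge II*, Publ. Math. IHÉS 40 (1971), §4.4 (4.4.2) p. 50.
-/

set_option autoImplicit false

noncomputable section

open scoped Manifold Topology
open Set Filter

namespace Literature.Geometry.ComplexAnalytic.IsRelExpChartOn

variable {EB : Type*} [NormedAddCommGroup EB] [NormedSpace ℂ EB] {B : Type*} [TopologicalSpace B] [ChartedSpace EB B]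
  {E : Type*} [NormedAddCommGroup E] [NormedSpace ℂ E] {ι : Type*}
  {EM : Type*} [NormedAddCommGroup EM] [NormedSpace ℂ EM] {M : Type*} [TopologicalSpace M] [ChartedSpace EM M]
  {p : M → B} {U : Set B} {Φ : B → ((ι → ℝ) ≃L[ℝ] E)} {ex : B × E → M}

/-- **RELATIVE EXPONENTIAL CHARTS ARE LOCAL ON THE BASE**: if every point `b ∈ U` has an open neighbourhood `V ⊆ U` carrying a relative
exponential chart `(Φ′, ex′)` of `p` which AGREES with `(Φ, ex)` on `V` (`Φ′ b′ = Φ b′`, `ex′ (b′, z) = ex (b′, z)` for `b′ ∈ V`), then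
`(Φ, ex)` is a relative exponential chart of `p` over `U`.  (Every clause of ★ `IsRelExpChartOn` is local at a point of `U`, resp. of
`U × E`; the exponential is a morphism of sheaves over the base.)
[cite: DeligneHodgeII1971, §4.4 (4.4.2) p. 50] [cite: BirkenhakeLange2004, §8.7] [cite: Shimura1963AnalyticFamilies, §2] -/
theorem of_local
    (h : ∀ b ∈ U, ∃ V : Set B, IsOpen V ∧ b ∈ V ∧ V ⊆ U ∧
      ∃ (Φ' : B → ((ι → ℝ) ≃L[ℝ] E)) (ex' : B × E → M), IsRelExpChartOn EB EM p V Φ' ex' ∧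
        (∀ b' ∈ V, Φ' b' = Φ b') ∧ ∀ b' ∈ V, ∀ z : E, ex' (b', z) = ex (b', z)) :
    IsRelExpChartOn EB EM p U Φ ex where
  isOpen := isOpen_iff_forall_mem_open.2 fun b hb => by
    obtain ⟨V, hVo, hbV, hVU, -⟩ := h b hb
    exact ⟨V, hVU, hVo, hbV⟩
  mdifferentiableOn_period x := by
    intro b hb
    obtain ⟨V, hVo, hbV, -, Φ', ex', hc, hΦ, -⟩ := h b hb
    have hat : MDifferentiableAt 𝓘(ℂ, EB) 𝓘(ℂ, E) (fun b' => Φ' b' x) b :=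
      (hc.mdifferentiableOn_period x b hbV).mdifferentiableAt (hVo.mem_nhds hbV)
    have hev : (fun b' => Φ b' x) =ᶠ[𝓝 b] fun b' => Φ' b' x :=
      eventuallyEq_of_mem (hVo.mem_nhds hbV) fun b' hb' => by rw [hΦ b' hb']
    exact (hat.congr_of_eventuallyEq hev).mdifferentiableWithinAt
  mdifferentiableOn_ex := by
    rintro ⟨b, z⟩ ⟨hb, -⟩
    obtain ⟨V, hVo, hbV, -, Φ', ex', hc, -, hex⟩ := h b hb
    have hnhds : V ×ˢ (univ : Set E) ∈ 𝓝 (b, z) := (hVo.prod isOpen_univ).mem_nhds ⟨hbV, mem_univ _⟩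
    have hat : MDifferentiableAt (𝓘(ℂ, EB).prod 𝓘(ℂ, E)) 𝓘(ℂ, EM) ex' (b, z) :=
      (hc.mdifferentiableOn_ex (b, z) ⟨hbV, mem_univ _⟩).mdifferentiableAt hnhds
    have hev : ex =ᶠ[𝓝 (b, z)] ex' :=
      eventuallyEq_of_mem hnhds fun q hq => (hex q.1 hq.1 q.2).symm
    exact (hat.congr_of_eventuallyEq hev).mdifferentiableWithinAt
  p_ex b hb z := by
    obtain ⟨V, -, hbV, -, Φ', ex', hc, -, hex⟩ := h b hb
    rw [← hex b hbV z]
    exact hc.p_ex b hbV z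
  ex_surj m hm := by
    obtain ⟨V, -, hbV, -, Φ', ex', hc, -, hex⟩ := h (p m) hm
    obtain ⟨z, hz⟩ := hc.ex_surj m hbV
    exact ⟨z, by rw [← hex _ hbV]; exact hz⟩
  ex_eq_ex_iff b hb z z' := by
    obtain ⟨V, -, hbV, -, Φ', ex', hc, hΦ, hex⟩ := h b hb
    rw [← hex b hbV z, ← hex b hbV z', hc.ex_eq_ex_iff b hbV z z', hΦ b hbV]
  exists_localInverse x hx := by
    obtain ⟨V, -, hbV, hVU, Φ', ex', hc, -, hex⟩ := h x.1 hx.1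
    obtain ⟨e, hxe, hsrc, heq, hd⟩ := hc.exists_localInverse x ⟨hbV, hx.2⟩
    refine ⟨e, hxe, fun y hy => ⟨hVU (hsrc hy).1, (hsrc hy).2⟩, fun y hy => ?_, hd⟩
    rw [heq y hy]
    exact hex y.1 (hsrc hy).1 y.2

/-- **A chart is insensitive to the values of `Φ` and `ex` on `U` up to pointwise agreement**: any pair `(Φ₂, ex₂)` agreeing with a
chart `(Φ, ex)` on `U` (resp. `U × E`) is a chart over `U` (the case `V = U` of `of_local`). [cite: BirkenhakeLange2004, §1.1] -/
theorem congr (hc : IsRelExpChartOn EB EM p U Φ ex) {Φ₂ : B → ((ι → ℝ) ≃L[ℝ] E)} {ex₂ : B × E → M}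
    (hΦ : ∀ b ∈ U, Φ₂ b = Φ b) (hex : ∀ b ∈ U, ∀ z : E, ex₂ (b, z) = ex (b, z)) :
    IsRelExpChartOn EB EM p U Φ₂ ex₂ :=
  of_local fun _ hb => ⟨U, hc.isOpen, hb, Subset.rfl, Φ, ex, hc, fun b' hb' => (hΦ b' hb').symm,
    fun b' hb' z => (hex b' hb' z).symm⟩

/-- **`of_local` with the period agreement stated on vectors** (`∀ x, Φ′ b′ x = Φ b′ x`, the shape delivered by ★
`SiegelModuli.periodFamily_eq_of_eq_siegelPeriodMap` for two tautological period families): charts near every point of `U` agreeing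
with `(Φ, ex)` make `(Φ, ex)` a chart over `U`. [cite: BirkenhakeLange2004, §8.7] [cite: Shimura1963AnalyticFamilies, §2] -/
theorem of_forall_exists_nhds
    (h : ∀ b ∈ U, ∃ V : Set B, IsOpen V ∧ b ∈ V ∧ V ⊆ U ∧
      ∃ (Φ' : B → ((ι → ℝ) ≃L[ℝ] E)) (ex' : B × E → M), IsRelExpChartOn EB EM p V Φ' ex' ∧
        (∀ b' ∈ V, ∀ x : ι → ℝ, Φ' b' x = Φ b' x) ∧ ∀ b' ∈ V, ∀ z : E, ex' (b', z) = ex (b', z)) :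
    IsRelExpChartOn EB EM p U Φ ex := by
  refine of_local fun b hb => ?_
  obtain ⟨V, hVo, hbV, hVU, Φ', ex', hc, hΦ, hex⟩ := h b hb
  exact ⟨V, hVo, hbV, hVU, Φ', ex', hc, fun b' hb' => ContinuousLinearEquiv.ext (funext fun x => hΦ b' hb' x), hex⟩

end Literature.Geometry.ComplexAnalytic.IsRelExpChartOn

end
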